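import Mathlib.Data.Fintype.CardEmbedding
import Literature.Computability.QuantumComplexity.BosonSamplingMainTheorem
import Literature.Computability.QuantumComplexity.ExactBosonSamplingHardness
import Literature.Computability.Complexity.ApproximateCounting
import Literature.Computability.Cryptography.SamplingProblemsProofs
import HarnessLib

/-!
# Approximate BosonSampling: the accounting of Aaronson–Arkhipov's proof of Thm. 1.3 (eqs. (5.78)–(5.97))

Family `quantum-advantage`; companion to `BosonSamplingHardness.lean` and
`BosonSamplingMainTheorem.lean`, which reduce the corrected statement **quantum-advantage.S21**
(`PSharpP_subset_BPPRelClass_NP_of_uniformApproxBosonSampling`) to the single named fact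
`gpeSolvableInFBPPRel_NPRel_of_approxBosonSamplingOracle` — S. Aaronson, A. Arkhipov, *The
computational complexity of linear optics*, Theory of Computing 9 (2013) 143–252 (AA13), **Thm. 1.3**
(Main Result; proof §5.2, pp. 192–195). That proof has three ingredients: the Hiding Lemma 5.8
(p. 191), Stockmeyer's approximate counting (Thm. 4.1, p. 175; proved in the tree,
`Complexity/StockmeyerMachines.lean`) and an elementary *accounting* — eqs. (5.78)–(5.97),
pp. 193–195 — which turns "the oracle's output distribution `𝒟'_A` is `β`-close to `𝒟_A`" into
"the estimate of the planted probability `p_{S*} = |Per(X')|²` is good except with probability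
`< δ`", through Markov's inequality over the planted position and the *symmetry principle* ("from
the perspective of `𝒪` — which sees only `A` and not `S*` or `X'` — the distribution over possible
values of `S*` is simply the uniform one", p. 194).

This file **proves the accounting**, in the tree's conventions (ordered outcomes, strings), so that a
discharge of Thm. 1.3 needs exactly the two procedural ingredients (a finite-precision Hiding Lemma
and the `FP^{NP^𝒪}` machine around the Stockmeyer counter) and nothing else:

* `plantedOutcome ι` — the outcome `S*` planted at the rows `ι : Fin n ↪ Fin m` (AA13's `S*` with
  `s_i = [i ∈ W]`, `W = range ι`, in the tree's *ordered* outcome format `encodeBosonOutcome ι`), and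
  its probability under `𝒟_A`: `p_ι = |Per(A_ι)|²/n!` (`toReal_bosonTargetPMF_plantedOutcome`,
  eq. (5.79); the ordered format divides AA13's `|Per(A_{S*})|²` by the `n!` orderings), with the
  scaling `|Per(X/√m)|² = |Per X|²/mⁿ` of eq. (5.78) (`norm_sq_permanent_inv_sqrt_smul`);
* `|G|`: the planted positions are the `m!/(m−n)!` injections (`card_plantedPositions`), and
  `2·mⁿ ≤ 3·m!/(m−n)!` once `3n² ≤ m` (`two_mul_pow_le_three_mul_descFactorial`) — the tree's form
  of "`1/|G_{m,n}| < 2·n!/mⁿ`, using `m = ω(n²)`" (eqs. (5.85), (5.90));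
* the target side of the outcome encoder (`bosonTargetPMF_encodeBosonOutcome`, via
  `pmf_map_apply_of_injective` of `ExactBosonSamplingHardness.lean`);
* the oracle's side (eq. (5.80)): the coin-taking oracle `𝒪` with coin polynomial `c` *is* the
  classical sampler `oracleRandAlg 𝒪 c` (`oracleCoinPMF 𝒪 c = (oracleRandAlg 𝒪 c).outputPMF id`,
  `oracleCoinPMF_eq_outputPMF`), so the mass `q_ι` its output law gives to the planted outcome is a
  witness count of the coin predicate `samplerRel (oracleRandAlg 𝒪 c)` of
  `ExactBosonSamplingHardness.lean` — the SAME relation the exact-case proof counts, and the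
  interface of the tree's relativised Stockmeyer theorem (`stockmeyerApproxCounting`, Thm. 4.1):
  `toReal_oracleCoinPMF_apply`, `plantedMass_oracleSamplePMF` (via `toReal_outputPMF_apply`); its
  accuracy notion `IsApproxCount` gives the relative error `|q̃ − q| ≤ q/kη` of eq. (5.89)
  (`abs_sub_le_of_isApproxCount`);
* Markov counting over planted positions from `‖𝒟_A − 𝒟'‖ ≤ β` (eqs. (5.81)–(5.87)):
  `∑_ι |p_ι − q_ι| ≤ 2β` (`sum_plantedDelta_le`, from `sum_abs_sub_le_two_mul_tvDist`), hence with
  `β = εδ/24` at most a `δ/4` fraction of the positions `ι` have `Δ_ι > (ε/2)/mⁿ`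
  (`card_badDelta_le`, eq. (5.87)); and `∑_ι q_ι ≤ 1` (`sum_plantedMass_le_one`), hence at most a
  `δ/4` fraction have `q_ι > (8/δ)/mⁿ` (`card_badMass_le`, eqs. (5.90)–(5.91) with `k = 4/δ`);
* the symmetry principle in kernel form (p. 194, eqs. (5.88), (5.92)): if for every `A` at most a
  `c` fraction of the positions is bad, then for `(A, ι)` with `ι` uniform and independent of `A` the
  bad event has probability `≤ c` — written, as `GPERandOracleSolves` writes joint probabilities, as
  the average over `ι` of the `μ`-measure of the `ι`-section (`avg_measureReal_sections_le`), and
  packaged for the two bad events (`avg_measureReal_badDelta_le`, `avg_measureReal_badMass_le`);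
* the deterministic combination (eqs. (5.93)–(5.95)): `|q̃ − q| ≤ αq`, `q ≤ (8/δ)/mⁿ`,
  `|p − q| ≤ (ε/2)/mⁿ`, `α = εδ/16` give `|q̃ − p| ≤ ε/mⁿ` (`abs_estimate_sub_planted_le`), and the
  failure budget (eqs. (5.96)–(5.97)): `δ/4 + (δ/4 + 2^{-m} + δ/4) < δ` as soon as `2^{-m} < δ/4`
  (`failure_budget_lt`).

Everything here is finite probability / measure bookkeeping over Mathlib and the tree's
`bosonTargetPMF`, `oracleCoinPMF`, `PMF.tvDist`, `samplerRel`, `countWitnesses`, `IsApproxCount`; all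
proved, no new facts. What is *not* here (and not in the tree):
the Hiding Lemma 5.8 in a finite-precision form (the law of `(round A, ι)` produced from
`X ∼ 𝒢^{n×n}` and coins versus `A` Haar-random with `ι` uniform and independent) and the oracle
machine; see `BosonSamplingHardness.lean`, "What a discharge of the Thm. 1.3 fact would need".

## Design choices

* **Ordered planted outcomes.** The tree's BosonSampling outcomes are ordered mode assignments
  `s : Fin n → Fin m` with `𝒟_A(s) = |Per(A_s)|²/n!` (`bosonSamplingPMF_apply`); AA13's collision-free
  outcome `S*` (occupation numbers of `W`) is the union of the `n!` orderings of `W`. We plant the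
  injection `ι` itself: `p_ι = |Per(A_ι)|²/n!`, the set `G_{m,n}` of size `C(m,n)` becomes the set of
  injections of size `n!·C(m,n) = m!/(m−n)!`, and every line of (5.82)–(5.92) holds with AA13's
  `n!/mⁿ` replaced by `1/mⁿ` and the same constants (`β = εδ/24`, `k = 4/δ`, `α = εδ/16`).
* **Non-strict inequalities.** AA13's Markov bounds are strict (`< 1/k`); we prove the `≤` forms, which
  is what the union bound consumes — the strict total `< δ` of (5.97) comes from `2^{-m} < δ/4`
  (`failure_budget_lt`).
* **Joint laws as averaged sections.** As in `GPERandOracleSolves`, a probability jointly over a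
  measure `μ` (on matrices, or on any space) and a uniform finite coordinate is the average over that
  coordinate of the `μ`-measure of the section; the symmetry principle is then Tonelli for a finite
  sum of indicators (`sum_measure_sections_le`). Measurability of the sections is a hypothesis, to be
  discharged by the consumer (there the sections are preimages of Borel sets under measurable maps);
  pointwise hypotheses on the hidden matrix are asked only `μ`-almost everywhere.

## References

* S. Aaronson, A. Arkhipov, *The computational complexity of linear optics*, Theory of Computing 9
  (2013) 143–252, doi:10.4086/toc.2013.v009a004: Thm. 1.3 (p. 152), proof §5.2: eq. (5.77) (p. 192),
  eqs. (5.78)–(5.81) (p. 193), (5.82)–(5.91) (p. 194), (5.92)–(5.97) (p. 195); Lemma 5.8 (p. 191);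
  Thm. 4.1 (p. 175).
-/

open MeasureTheory Matrix Finset Computability Literature.Computability.Cryptography
  Literature.Computability.Complexity
open scoped ENNReal

namespace Literature.Computability.QuantumComplexity

variable {m n : ℕ}

/-! ### Planted outcomes and their probabilities (eqs. (5.78)–(5.79)) -/

/-- The outcome **planted at the rows `ι`**: AA13's collision-free basis state `S*` ("`s_i = 1` if
`i ∈ W` and `s_i = 0` otherwise", `W` the rows of `A` in which `X'` occurs, p. 193) in the tree's
ordered outcome format — the string `encodeBosonOutcome ι` of the mode assignment "photon `i` in mode
`ι i`". [cite: AaronsonArkhipovToC2013, proof of Thm. 1.3, definition of S* (p. 193)] -/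
def plantedOutcome (ι : Fin n ↪ Fin m) : List Bool :=
  encodeBosonOutcome (ι : Fin n → Fin m)

/-- Distinct planted positions give distinct planted outcomes. [folklore] -/
theorem plantedOutcome_injective : Function.Injective (plantedOutcome (m := m) (n := n)) :=
  fun _ _ h => DFunLike.coe_injective (encodeBosonOutcome_injective m n h)

/-- On an instance with at least one mode, the target probability of the ordered outcome `s` is
`𝒟_A(s)` (the outcome encoder is injective). [cite: AaronsonArkhipovToC2013, §5.2 eq. (5.77) (p. 192)] -/
theorem bosonTargetPMF_encodeBosonOutcome [NeZero m] (U : Matrix (Fin m) (Fin n) ℂ)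
    (s : Fin n → Fin m) : bosonTargetPMF U (encodeBosonOutcome s) = bosonSamplingPMF U s := by
  rw [bosonTargetPMF_of_neZero]
  exact pmf_map_apply_of_injective _ (encodeBosonOutcome_injective m n) s

/-- A planted position witnesses `n ≤ m`. [folklore] -/
theorem le_of_plantedPosition (ι : Fin n ↪ Fin m) : n ≤ m := by
  simpa using Fintype.card_le_of_embedding ι

/-- **Eq. (5.79), ordered form: the planted probability is a squared permanent.** For a
column-orthonormal `A ∈ 𝒰_{m,n}` the planted outcome has probability
`p_ι = 𝒟_A(S*_ι) = |Per(A_ι)|²/n!`, `A_ι` the `n × n` block of `A` on the rows `ι` (AA13: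
`p_{S*} = |Per(A_{S*})|²/(s₁!⋯s_m!) = |Per(X')|²`; the ordered outcome carries `1/n!` of it).
[cite: AaronsonArkhipovToC2013, proof of Thm. 1.3, eq. (5.79) (p. 193)] -/
theorem toReal_bosonTargetPMF_plantedOutcome [NeZero m] {U : Matrix (Fin m) (Fin n) ℂ}
    (hU : IsColumnOrthonormal U) (ι : Fin n ↪ Fin m) :
    (bosonTargetPMF U (plantedOutcome ι)).toReal =
      ‖(U.submatrix ι id).permanent‖ ^ 2 / n.factorial := by
  rw [plantedOutcome, bosonTargetPMF_encodeBosonOutcome,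
    bosonSamplingPMF_apply_holds hU (le_of_plantedPosition ι),
    ENNReal.toReal_ofReal (bosonWeight_nonneg U _)]
  rfl

/-- **Eq. (5.78): the scaling of the planted block.** `|Per(X/√m)|² = |Per(X)|²/mⁿ` (the permanent
is homogeneous of degree `n`), so estimating `p_{S*}` to `± ε·n!/mⁿ` is estimating `|Per X|²` to
`± ε·n!`. [cite: AaronsonArkhipovToC2013, proof of Thm. 1.3, eq. (5.78) (p. 193)] -/
theorem norm_sq_permanent_inv_sqrt_smul (X : Matrix (Fin n) (Fin n) ℂ) (hm : 0 < m) :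
    ‖(((Real.sqrt m)⁻¹ : ℝ) • X).permanent‖ ^ 2 = ‖X.permanent‖ ^ 2 / (m : ℝ) ^ n := by
  have hsm : 0 < Real.sqrt m := Real.sqrt_pos.2 (by exact_mod_cast hm)
  have hsmul : ((Real.sqrt m)⁻¹ : ℝ) • X = (((Real.sqrt m)⁻¹ : ℝ) : ℂ) • X := by
    ext i j
    simp [Matrix.smul_apply, Complex.real_smul]
  rw [hsmul, Matrix.permanent_smul, Fintype.card_fin, norm_mul, norm_pow, Complex.norm_real,
    Real.norm_of_nonneg (inv_nonneg.2 hsm.le), mul_pow, ← pow_mul, inv_pow,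
    show n * 2 = 2 * n from mul_comm _ _, pow_mul, Real.sq_sqrt (by exact_mod_cast hm.le)]
  rw [inv_mul_eq_div]

/-! ### The number of planted positions (eqs. (5.85), (5.90): `|G_{m,n}|` versus `mⁿ`) -/

/-- The planted positions are the `m!/(m−n)! = m(m−1)⋯(m−n+1)` injections `Fin n ↪ Fin m`
(ordered version of `|G_{m,n}| = C(m,n)`). [folklore] -/
theorem card_plantedPositions (m n : ℕ) : Fintype.card (Fin n ↪ Fin m) = m.descFactorial n := by
  rw [Fintype.card_embedding_eq, Fintype.card_fin, Fintype.card_fin]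

/-- **"`m = ω(n²)`" quantitatively**: for `3n² ≤ m`, `2·mⁿ ≤ 3·m!/(m−n)!`, i.e.
`1/|positions| ≤ (3/2)/mⁿ` — the tree's form of AA13's `2β/C(m,n) < 3β·n!/mⁿ` (eq. (5.85)) and
`1/C(m,n) < 2·n!/mⁿ` (eq. (5.90)). Proof: `m!/(m−n)! ≥ (m+1−n)ⁿ ≥ (m−n)ⁿ = mⁿ(1 − n/m)ⁿ ≥
mⁿ(1 − n²/m) ≥ (2/3)mⁿ` (Bernoulli). [cite: AaronsonArkhipovToC2013, proof of Thm. 1.3, eqs. (5.85) and (5.90) (p. 194)] -/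
theorem two_mul_pow_le_three_mul_descFactorial (hnm : 3 * n ^ 2 ≤ m) :
    2 * (m : ℝ) ^ n ≤ 3 * (m.descFactorial n : ℝ) := by
  rcases Nat.eq_zero_or_pos n with rfl | hn
  · norm_num
  have hm : 0 < m := lt_of_lt_of_le (by positivity) hnm
  have hmR : (0 : ℝ) < m := by exact_mod_cast hm
  have hnm' : n ≤ m := by nlinarith
  -- `(m - n)^n ≤ descFactorial`
  have h1 : ((m : ℝ) - n) ^ n ≤ (m.descFactorial n : ℝ) := by
    have := Nat.pow_sub_le_descFactorial m n
    have hcast : (((m + 1 - n) ^ n : ℕ) : ℝ) ≤ (m.descFactorial n : ℝ) := by exact_mod_cast this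
    refine le_trans ?_ hcast
    rw [Nat.cast_pow]
    apply pow_le_pow_left₀ (by rw [sub_nonneg]; exact_mod_cast hnm')
    rw [Nat.cast_sub (by omega), Nat.cast_add, Nat.cast_one]
    linarith
  -- Bernoulli: `(1 - n/m)^n ≥ 1 - n·(n/m) ≥ 2/3`
  have h2 : (1 : ℝ) - n * ((n : ℝ) / m) ≤ (1 - (n : ℝ) / m) ^ n := by
    have hle : (-2 : ℝ) ≤ -((n : ℝ) / m) := by
      have : (n : ℝ) / m ≤ 1 := by
        rw [div_le_one hmR]; exact_mod_cast hnm'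
      linarith
    have := one_add_mul_le_pow hle n
    simpa [sub_eq_add_neg, mul_neg] using this
  have h3 : (2 : ℝ) / 3 ≤ 1 - n * ((n : ℝ) / m) := by
    have : (n : ℝ) * ((n : ℝ) / m) ≤ 1 / 3 := by
      rw [mul_div_assoc', div_le_div_iff₀ hmR (by norm_num : (0 : ℝ) < 3)]
      have : (3 * n ^ 2 : ℕ) ≤ (m : ℝ) := by exact_mod_cast hnm
      push_cast at this
      nlinarith
    linarith
  have h4 : ((m : ℝ) - n) ^ n = (m : ℝ) ^ n * (1 - (n : ℝ) / m) ^ n := by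
    rw [← mul_pow]
    congr 1
    field_simp
  have hpow : (0 : ℝ) ≤ (m : ℝ) ^ n := by positivity
  calc 2 * (m : ℝ) ^ n = 3 * ((m : ℝ) ^ n * (2 / 3)) := by ring
    _ ≤ 3 * ((m : ℝ) ^ n * (1 - (n : ℝ) / m) ^ n) := by
        gcongr
        exact h3.trans h2
    _ = 3 * ((m : ℝ) - n) ^ n := by rw [h4]
    _ ≤ 3 * (m.descFactorial n : ℝ) := by gcongr

/-- The number of planted positions is positive once `n ≤ m`. [folklore] -/
theorem card_plantedPositions_pos (h : n ≤ m) : 0 < Fintype.card (Fin n ↪ Fin m) := by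
  rw [card_plantedPositions]
  exact Nat.descFactorial_pos.2 h

/-- `3n² ≤ m` gives `n ≤ m`. [folklore] -/
theorem le_of_three_mul_sq_le (hnm : 3 * n ^ 2 ≤ m) : n ≤ m := by
  nlinarith [Nat.zero_le n]

/-! ### Markov counting over planted positions (eqs. (5.81)–(5.87), (5.90)–(5.91)) -/

/-- **Eq. (5.81)–(5.84): restricting the variation distance to the planted outcomes.** For an
injective family of outcomes `e`, `∑_i |p(e i) − q(e i)| ≤ 2‖p − q‖` (the sum over all outcomes is
`2‖p − q‖`, eq. (5.81)). [cite: AaronsonArkhipovToC2013, proof of Thm. 1.3, eqs. (5.81)–(5.84) (pp. 193–194)] -/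
theorem sum_abs_sub_le_two_mul_tvDist {Ω I : Type*} [Fintype I] (p q : PMF Ω) {e : I → Ω}
    (he : Function.Injective e) :
    ∑ i, |(p (e i)).toReal - (q (e i)).toReal| ≤ 2 * p.tvDist q := by
  classical
  have hsum : Summable fun ω => |(p ω).toReal - (q ω).toReal| := by
    refine Summable.of_nonneg_of_le (fun _ => abs_nonneg _) (fun ω => ?_)
      ((ENNReal.summable_toReal p.tsum_coe_ne_top).add (ENNReal.summable_toReal q.tsum_coe_ne_top))
    have hp : 0 ≤ (p ω).toReal := ENNReal.toReal_nonneg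
    have hq : 0 ≤ (q ω).toReal := ENNReal.toReal_nonneg
    rw [abs_le]
    constructor <;> linarith
  calc ∑ i, |(p (e i)).toReal - (q (e i)).toReal|
      = ∑ ω ∈ Finset.univ.map ⟨e, he⟩, |(p ω).toReal - (q ω).toReal| := by
        rw [Finset.sum_map]
        rfl
    _ ≤ ∑' ω, |(p ω).toReal - (q ω).toReal| :=
        hsum.sum_le_tsum _ fun _ _ => abs_nonneg _
    _ = 2 * p.tvDist q := by
        rw [PMF.tvDist]
        ring

/-- **Masses of distinct outcomes sum to at most one**: `∑_i q(e i) ≤ 1` for injective `e` — the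
source of `E_S[q_S] ≤ 1/|G_{m,n}|` (eq. (5.90)). [cite: AaronsonArkhipovToC2013, proof of Thm. 1.3, eq. (5.90) (p. 194)] -/
theorem sum_toReal_le_one {Ω I : Type*} [Fintype I] (q : PMF Ω) {e : I → Ω}
    (he : Function.Injective e) : ∑ i, (q (e i)).toReal ≤ 1 := by
  classical
  have h1 : ∑ i, q (e i) ≤ 1 := by
    calc ∑ i, q (e i) = ∑ ω ∈ Finset.univ.map ⟨e, he⟩, q ω := by rw [Finset.sum_map]; rfl
      _ ≤ ∑' ω, q ω := ENNReal.sum_le_tsum _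
      _ = 1 := q.tsum_coe
  have h2 : ∑ i, (q (e i)).toReal = (∑ i, q (e i)).toReal :=
    (ENNReal.toReal_sum fun i _ => q.apply_ne_top _).symm
  rw [h2]
  calc (∑ i, q (e i)).toReal ≤ (1 : ℝ≥0∞).toReal := by
        exact ENNReal.toReal_mono ENNReal.one_ne_top h1
    _ = 1 := by simp

/-- **Markov's inequality, counting form**: for a nonnegative `f` on a finite set, the number of
points with `f > t` times `t` is at most `∑ f`. [folklore] -/
theorem card_filter_lt_mul_le_sum {I : Type*} [Fintype I] (f : I → ℝ) (hf : ∀ i, 0 ≤ f i)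
    (t : ℝ) [DecidablePred fun i => t < f i] :
    ((Finset.univ.filter fun i => t < f i).card : ℝ) * t ≤ ∑ i, f i := by
  calc ((Finset.univ.filter fun i => t < f i).card : ℝ) * t
      = ∑ _i ∈ Finset.univ.filter (fun i => t < f i), t := by
        rw [Finset.sum_const, nsmul_eq_mul]
    _ ≤ ∑ i ∈ Finset.univ.filter (fun i => t < f i), f i :=
        Finset.sum_le_sum fun i hi => (Finset.mem_filter.1 hi).2.le
    _ ≤ ∑ i, f i :=
        Finset.sum_le_sum_of_subset_of_nonneg (Finset.filter_subset _ _) fun i _ _ => hf i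

/-- `Δ_ι := |p_ι − q_ι|`, the discrepancy at the planted outcome between the BosonSampling
distribution `𝒟_A` and a distribution `𝒟'` (the oracle's output law at the query), as a real
number. [cite: AaronsonArkhipovToC2013, proof of Thm. 1.3, definition of Δ_S (p. 193)] -/
noncomputable def plantedDelta (U : Matrix (Fin m) (Fin n) ℂ) (D : PMF (List Bool))
    (ι : Fin n ↪ Fin m) : ℝ :=
  |(bosonTargetPMF U (plantedOutcome ι)).toReal - (D (plantedOutcome ι)).toReal|

/-- `q_ι := 𝒟'(S*_ι)`, the mass the distribution `𝒟'` gives to the planted outcome, as a real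
number. [cite: AaronsonArkhipovToC2013, proof of Thm. 1.3, eq. (5.80) (p. 193)] -/
noncomputable def plantedMass (D : PMF (List Bool)) (ι : Fin n ↪ Fin m) : ℝ :=
  (D (plantedOutcome ι)).toReal

/-- `Δ_ι ≥ 0`. [folklore] -/
theorem plantedDelta_nonneg (U : Matrix (Fin m) (Fin n) ℂ) (D : PMF (List Bool))
    (ι : Fin n ↪ Fin m) : 0 ≤ plantedDelta U D ι :=
  abs_nonneg _

/-- `q_ι ≥ 0`. [folklore] -/
theorem plantedMass_nonneg (D : PMF (List Bool)) (ι : Fin n ↪ Fin m) : 0 ≤ plantedMass D ι :=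
  ENNReal.toReal_nonneg

/-- **Eqs. (5.82)–(5.84): `∑_ι Δ_ι ≤ 2‖𝒟_A − 𝒟'‖`** (so `E_ι[Δ_ι] ≤ 2β/|positions|`).
[cite: AaronsonArkhipovToC2013, proof of Thm. 1.3, eqs. (5.82)–(5.84) (p. 194)] -/
theorem sum_plantedDelta_le (U : Matrix (Fin m) (Fin n) ℂ) (D : PMF (List Bool)) :
    ∑ ι : Fin n ↪ Fin m, plantedDelta U D ι ≤ 2 * D.tvDist (bosonTargetPMF U) := by
  rw [PMF.tvDist_comm]
  exact sum_abs_sub_le_two_mul_tvDist (bosonTargetPMF U) D plantedOutcome_injective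

/-- **`∑_ι q_ι ≤ 1`** (the planted outcomes are distinct), the tree's form of
`E_S[q_S] ≤ 1/|G_{m,n}|`, eq. (5.90). [cite: AaronsonArkhipovToC2013, proof of Thm. 1.3, eq. (5.90) (p. 194)] -/
theorem sum_plantedMass_le_one (D : PMF (List Bool)) :
    ∑ ι : Fin n ↪ Fin m, plantedMass D ι ≤ 1 :=
  sum_toReal_le_one D plantedOutcome_injective

open Classical in
/-- **Eq. (5.87) (Markov over the planted position, `k = 4/δ`).** If `‖𝒟_A − 𝒟'‖ ≤ β = εδ/24` and
`3n² ≤ m`, then the planted positions `ι` with `Δ_ι > (ε/2)/mⁿ` are at most a `δ/4` fraction of all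
`m!/(m−n)!` positions: their number times `(ε/2)/mⁿ` is at most `∑ Δ ≤ 2β = εδ/12`, and
`mⁿ ≤ (3/2)·m!/(m−n)!`. (AA13: `Pr_{S ∈ G_{m,n}}[Δ_S > (ε/2)·n!/mⁿ] < δ/4`.)
[cite: AaronsonArkhipovToC2013, proof of Thm. 1.3, eqs. (5.85)–(5.87) (p. 194)] -/
theorem card_badDelta_le {U : Matrix (Fin m) (Fin n) ℂ} {D : PMF (List Bool)} {ε δ : ℝ}
    (hε : 0 < ε) (hδ : 0 ≤ δ) (hnm : 3 * n ^ 2 ≤ m)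
    (hD : D.tvDist (bosonTargetPMF U) ≤ ε * δ / 24) :
    ((Finset.univ.filter fun ι : Fin n ↪ Fin m => ε / 2 / (m : ℝ) ^ n < plantedDelta U D ι).card
        : ℝ) ≤ δ / 4 * Fintype.card (Fin n ↪ Fin m) := by
  rcases Nat.eq_zero_or_pos m with rfl | hm
  · -- no modes: then `n = 0`, one position, and `Δ ≤ 2‖·‖ ≤ εδ/12 < ε/2` unless the set is empty
    have hn : n = 0 := by
      rcases Nat.eq_zero_or_pos n with h | h
      · exact h
      · exfalso
        have : 3 * n ^ 2 ≤ 0 := hnm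
        nlinarith
    subst hn
    have hcard : Fintype.card (Fin 0 ↪ Fin 0) = 1 := by
      rw [card_plantedPositions]; rfl
    rw [hcard, Nat.cast_one, mul_one]
    -- every position has `Δ ≤ εδ/12`, and `εδ/12 < ε/2` would need `δ < 6`; argue via the sum
    by_contra hlt
    push Not at hlt
    have hpos : 0 < (Finset.univ.filter fun ι : Fin 0 ↪ Fin 0 =>
        ε / 2 / ((0 : ℕ) : ℝ) ^ 0 < plantedDelta U D ι).card := by
      by_contra h0
      push Not at h0
      have : ((Finset.univ.filter fun ι : Fin 0 ↪ Fin 0 =>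
          ε / 2 / ((0 : ℕ) : ℝ) ^ 0 < plantedDelta U D ι).card : ℝ) = 0 := by
        exact_mod_cast Nat.le_zero.1 h0
      rw [this] at hlt
      linarith
    obtain ⟨ι, hι⟩ := Finset.card_pos.1 hpos
    have hι' := (Finset.mem_filter.1 hι).2
    simp only [pow_zero, div_one] at hι'
    have hsum := sum_plantedDelta_le U D
    have hle : plantedDelta U D ι ≤ ∑ κ : Fin 0 ↪ Fin 0, plantedDelta U D κ :=
      Finset.single_le_sum (fun κ _ => plantedDelta_nonneg U D κ) (Finset.mem_univ ι)
    have hcardle : ((Finset.univ.filter fun ι : Fin 0 ↪ Fin 0 =>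
        ε / 2 / ((0 : ℕ) : ℝ) ^ 0 < plantedDelta U D ι).card : ℝ) ≤ 1 := by
      have := Finset.card_filter_le (Finset.univ : Finset (Fin 0 ↪ Fin 0))
        (fun ι => ε / 2 / ((0 : ℕ) : ℝ) ^ 0 < plantedDelta U D ι)
      rw [Finset.card_univ, hcard] at this
      exact_mod_cast this
    -- from `ε/2 < Δ ≤ εδ/12` get `6 < δ`, contradicting `card ≤ 1 ≤ δ/4`? no: use both bounds
    have h6 : ε / 2 < ε * δ / 12 := by linarith
    have hδ6 : 6 < δ := by nlinarith
    linarith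
  have hmn : 0 < (m : ℝ) ^ n := by positivity
  have ht : 0 < ε / 2 / (m : ℝ) ^ n := by positivity
  have hmarkov := card_filter_lt_mul_le_sum (plantedDelta U D) (plantedDelta_nonneg U D)
    (ε / 2 / (m : ℝ) ^ n)
  have hsum := sum_plantedDelta_le U D
  have hdesc := two_mul_pow_le_three_mul_descFactorial hnm
  rw [← card_plantedPositions] at hdesc
  set c : ℝ := ((Finset.univ.filter fun ι : Fin n ↪ Fin m =>
    ε / 2 / (m : ℝ) ^ n < plantedDelta U D ι).card : ℝ) with hc
  have hc0 : 0 ≤ c := by positivity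
  -- `c · (ε/2)/mⁿ ≤ εδ/12`, i.e. `c ≤ δ mⁿ/6 ≤ (δ/4)·descFactorial`
  have h1 : c * (ε / 2 / (m : ℝ) ^ n) ≤ ε * δ / 12 := by linarith
  have h2 : c ≤ δ / 6 * (m : ℝ) ^ n := by
    rw [← le_div_iff₀ ht] at h1
    refine h1.trans (le_of_eq ?_)
    field_simp
    ring
  calc c ≤ δ / 6 * (m : ℝ) ^ n := h2
    _ ≤ δ / 6 * (3 / 2 * (Fintype.card (Fin n ↪ Fin m) : ℝ)) := by gcongr; linarith
    _ = δ / 4 * Fintype.card (Fin n ↪ Fin m) := by ring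

open Classical in
/-- **Eq. (5.91) (Markov for the planted mass, `k = 4/δ`).** If `3n² ≤ m`, the planted positions
`ι` with `q_ι > (8/δ)/mⁿ` are at most a `δ/4` fraction of all positions: their number times
`(8/δ)/mⁿ` is at most `∑ q ≤ 1`, and `mⁿ ≤ (3/2)·m!/(m−n)!` (giving the fraction `3δ/16 ≤ δ/4`).
(AA13: `Pr_{S ∈ G_{m,n}}[q_S > 2k·n!/mⁿ] < 1/k`.) [cite: AaronsonArkhipovToC2013, proof of Thm. 1.3, eqs. (5.90)–(5.91) (p. 194)] -/
theorem card_badMass_le {D : PMF (List Bool)} {δ : ℝ} (hδ : 0 < δ) (hnm : 3 * n ^ 2 ≤ m)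
    (hm : 0 < m) :
    ((Finset.univ.filter fun ι : Fin n ↪ Fin m => 8 / δ / (m : ℝ) ^ n < plantedMass D ι).card
        : ℝ) ≤ δ / 4 * Fintype.card (Fin n ↪ Fin m) := by
  have hmn : 0 < (m : ℝ) ^ n := by positivity
  have ht : 0 < 8 / δ / (m : ℝ) ^ n := by positivity
  have hmarkov := card_filter_lt_mul_le_sum (fun ι : Fin n ↪ Fin m => plantedMass D ι)
    (fun ι => plantedMass_nonneg D ι) (8 / δ / (m : ℝ) ^ n)
  have hsum : ∑ ι : Fin n ↪ Fin m, plantedMass D ι ≤ 1 := sum_plantedMass_le_one D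
  have hdesc := two_mul_pow_le_three_mul_descFactorial hnm
  rw [← card_plantedPositions] at hdesc
  set c : ℝ := ((Finset.univ.filter fun ι : Fin n ↪ Fin m =>
    8 / δ / (m : ℝ) ^ n < plantedMass D ι).card : ℝ) with hc
  have hc0 : 0 ≤ c := by positivity
  have h1 : c * (8 / δ / (m : ℝ) ^ n) ≤ 1 := hmarkov.trans hsum
  have h2 : c ≤ δ / 8 * (m : ℝ) ^ n := by
    rw [← le_div_iff₀ ht] at h1
    refine h1.trans (le_of_eq ?_)
    field_simp
  calc c ≤ δ / 8 * (m : ℝ) ^ n := h2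
    _ ≤ δ / 8 * (3 / 2 * (Fintype.card (Fin n ↪ Fin m) : ℝ)) := by gcongr; linarith
    _ = 3 * δ / 16 * Fintype.card (Fin n ↪ Fin m) := by ring
    _ ≤ δ / 4 * Fintype.card (Fin n ↪ Fin m) := by
        apply mul_le_mul_of_nonneg_right _ (Nat.cast_nonneg _)
        linarith

/-! ### The symmetry principle (p. 194; eqs. (5.88), (5.92)) -/

open Classical in
/-- **Tonelli for finitely many sections.** If every point `a` lies in at most `c` of the measurable
sets `B i`, then `∑_i μ(B i) ≤ c · μ(univ)`. [folklore] -/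
theorem sum_measure_sections_le {𝒜 I : Type*} [MeasurableSpace 𝒜] [Fintype I] (μ : Measure 𝒜)
    (B : I → Set 𝒜) (hB : ∀ i, MeasurableSet (B i)) (c : ℝ≥0∞)
    (hc : ∀ᵐ a ∂μ, ((Finset.univ.filter fun i => a ∈ B i).card : ℝ≥0∞) ≤ c) :
    ∑ i, μ (B i) ≤ c * μ Set.univ := by
  have h1 : ∑ i, μ (B i) = ∫⁻ a, ∑ i, (B i).indicator (1 : 𝒜 → ℝ≥0∞) a ∂μ := by
    rw [lintegral_finsetSum _ fun i _ => measurable_one.indicator (hB i)]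
    exact Finset.sum_congr rfl fun i _ => (lintegral_indicator_one (hB i)).symm
  have h2 : ∀ a, ∑ i, (B i).indicator (1 : 𝒜 → ℝ≥0∞) a =
      ((Finset.univ.filter fun i => a ∈ B i).card : ℝ≥0∞) := by
    intro a
    simp only [Set.indicator_apply, Pi.one_apply]
    rw [Finset.sum_boole]
  rw [h1]
  calc ∫⁻ a, ∑ i, (B i).indicator (1 : 𝒜 → ℝ≥0∞) a ∂μ ≤ ∫⁻ _a, c ∂μ :=
        lintegral_mono_ae (hc.mono fun a ha => by rw [h2 a]; exact ha)
    _ = c * μ Set.univ := lintegral_const c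

open Classical in
/-- **The symmetry principle, kernel form** (AA13 p. 194: "from the perspective of `𝒪` — which sees
only `A` and not `S*` or `X'` — the distribution over possible values of `S*` is simply the uniform
one … so even if `𝒪` is trying adversarially to maximize `Δ_{S*}` we still have" (5.88); "by the
same symmetry principle" (5.92)). If for (`μ`-almost) every `a` at most a `c` fraction of the
finitely many positions `i` is bad (`a ∈ B i`), then for `a ∼ μ` (a probability measure) and an
independent uniformly random position the bad event has probability at most `c` — written as the
average over the position of the `μ`-probability of the section, the way `GPERandOracleSolves`
writes joint probabilities. [cite: AaronsonArkhipovToC2013, proof of Thm. 1.3, symmetry principle (p. 194)] -/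
theorem avg_measureReal_sections_le {𝒜 I : Type*} [MeasurableSpace 𝒜] [Fintype I] [Nonempty I]
    (μ : Measure 𝒜) [IsProbabilityMeasure μ] (B : I → Set 𝒜) (hB : ∀ i, MeasurableSet (B i))
    {c : ℝ} (hc0 : 0 ≤ c)
    (hc : ∀ᵐ a ∂μ, ((Finset.univ.filter fun i => a ∈ B i).card : ℝ) ≤ c * Fintype.card I) :
    (∑ i, μ.real (B i)) / Fintype.card I ≤ c := by
  have hI : (0 : ℝ) < Fintype.card I := by exact_mod_cast Fintype.card_pos
  have key := sum_measure_sections_le μ B hB (ENNReal.ofReal (c * Fintype.card I))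
    (hc.mono fun a this => by
      calc ((Finset.univ.filter fun i => a ∈ B i).card : ℝ≥0∞)
          = ENNReal.ofReal ((Finset.univ.filter fun i => a ∈ B i).card : ℝ) := by
            rw [ENNReal.ofReal_natCast]
        _ ≤ ENNReal.ofReal (c * Fintype.card I) := ENNReal.ofReal_le_ofReal this)
  rw [measure_univ, mul_one] at key
  have hsum : ∑ i, μ.real (B i) = (∑ i, μ (B i)).toReal := by
    rw [ENNReal.toReal_sum fun i _ => measure_ne_top μ _]
    rfl
  rw [hsum, div_le_iff₀ hI]
  calc (∑ i, μ (B i)).toReal ≤ (ENNReal.ofReal (c * Fintype.card I)).toReal :=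
        ENNReal.toReal_mono ENNReal.ofReal_ne_top key
    _ = c * Fintype.card I := ENNReal.toReal_ofReal (by positivity)

open Classical in
/-- **Eq. (5.88): `Pr_{A,ι}[Δ_ι > (ε/2)/mⁿ] ≤ δ/4`.** For any law `μ` of what the oracle sees
(read as a matrix through `A`, and answered by the response `D a`, the oracle's output law at that
query) such that `‖D a − 𝒟_{A a}‖ ≤ εδ/24` for `μ`-almost every `a`, and an independent uniformly
random planted position `ι` (`3n² ≤ m`, `n ≤ m`): the joint probability of a bad discrepancy,
written as the average over `ι` of the `μ`-measure of the section, is at most `δ/4`. Measurability of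
the sections is assumed. [cite: AaronsonArkhipovToC2013, proof of Thm. 1.3, eq. (5.88) (p. 194)] -/
theorem avg_measureReal_badDelta_le {𝒜 : Type*} [MeasurableSpace 𝒜] (μ : Measure 𝒜)
    [IsProbabilityMeasure μ] (A : 𝒜 → Matrix (Fin m) (Fin n) ℂ) (D : 𝒜 → PMF (List Bool))
    {ε δ : ℝ} (hε : 0 < ε) (hδ : 0 ≤ δ) (hnm : 3 * n ^ 2 ≤ m)
    (hD : ∀ᵐ a ∂μ, (D a).tvDist (bosonTargetPMF (A a)) ≤ ε * δ / 24)
    (hmeas : ∀ ι : Fin n ↪ Fin m,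
      MeasurableSet {a | ε / 2 / (m : ℝ) ^ n < plantedDelta (A a) (D a) ι}) :
    (∑ ι : Fin n ↪ Fin m, μ.real {a | ε / 2 / (m : ℝ) ^ n < plantedDelta (A a) (D a) ι}) /
        Fintype.card (Fin n ↪ Fin m) ≤ δ / 4 := by
  haveI : Nonempty (Fin n ↪ Fin m) :=
    Fintype.card_pos_iff.1 (card_plantedPositions_pos (le_of_three_mul_sq_le hnm))
  refine avg_measureReal_sections_le μ _ hmeas (by positivity) (hD.mono fun a ha => ?_)
  have := card_badDelta_le (U := A a) (D := D a) hε hδ hnm ha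
  simpa using this

open Classical in
/-- **Eq. (5.92): `Pr_{A,ι}[q_ι > (8/δ)/mⁿ] ≤ δ/4`** ("by the same symmetry principle used
previously for `Δ_{S*}`"), in the same averaged-section form, for any response `D a` and an
independent uniformly random planted position (`3n² ≤ m`, `0 < m`). [cite: AaronsonArkhipovToC2013, proof of Thm. 1.3, eq. (5.92) (p. 195)] -/
theorem avg_measureReal_badMass_le {𝒜 : Type*} [MeasurableSpace 𝒜] (μ : Measure 𝒜)
    [IsProbabilityMeasure μ] (D : 𝒜 → PMF (List Bool)) {δ : ℝ} (hδ : 0 < δ)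
    (hnm : 3 * n ^ 2 ≤ m) (hm : 0 < m)
    (hmeas : ∀ ι : Fin n ↪ Fin m, MeasurableSet {a | 8 / δ / (m : ℝ) ^ n < plantedMass (D a) ι}) :
    (∑ ι : Fin n ↪ Fin m, μ.real {a | 8 / δ / (m : ℝ) ^ n < plantedMass (D a) ι}) /
        Fintype.card (Fin n ↪ Fin m) ≤ δ / 4 := by
  haveI : Nonempty (Fin n ↪ Fin m) :=
    Fintype.card_pos_iff.1 (card_plantedPositions_pos (le_of_three_mul_sq_le hnm))
  refine avg_measureReal_sections_le μ _ hmeas (by positivity) (ae_of_all μ fun a => ?_)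
  have := card_badMass_le (D := D a) hδ hnm hm
  simpa using this

/-! ### The oracle's side: planted mass as a witness count, and Stockmeyer's accuracy (eqs. (5.80), (5.89)) -/

/-- **The coin-taking oracle as a classical sampler.** The oracle `𝒪` queried on `⟨x, r⟩` with a
coin block of length `c(|x|)` *is* the randomised algorithm `(x; r) ↦ 𝒪(⟨x, r⟩)` with coin budget
`c` (AA13 Thm. 1.1, p. 149: "a deterministic algorithm that takes a random string `r` as part of its
input"; Def. 3.11); through this wrapper the approximate-case proof counts the same coin predicate
`samplerRel` (`ExactBosonSamplingHardness.lean`) as the exact-case proof of Thm. 1.1.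
[cite: AaronsonArkhipovToC2013, Def. 3.11 (p. 174) with Thm. 1.1 (p. 149)] -/
def oracleRandAlg (O : Oracle) (c : Polynomial ℕ) : RandAlg (List Bool) (List Bool) :=
  ⟨fun x r => O (boolPair x r), fun k => c.eval k⟩

/-- The sampler runs the oracle on the paired query. [folklore] -/
@[simp] theorem oracleRandAlg_run (O : Oracle) (c : Polynomial ℕ) (x r : List Bool) :
    (oracleRandAlg O c).run x r = O (boolPair x r) :=
  rfl

/-- Its coin budget is the oracle's coin polynomial. [folklore] -/
@[simp] theorem oracleRandAlg_coinLen (O : Oracle) (c : Polynomial ℕ) (k : ℕ) :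
    (oracleRandAlg O c).coinLen k = c.eval k :=
  rfl

/-- **`𝒟_𝒪` is the output distribution of that sampler**: `oracleCoinPMF 𝒪 c x` (Def. 3.11, "the
distribution over outputs of `𝒪` if `A` and `ε` are fixed but `r` is uniformly random") is
`(oracleRandAlg 𝒪 c).outputPMF id x`. [cite: AaronsonArkhipovToC2013, Def. 3.11 (p. 174)] -/
theorem oracleCoinPMF_eq_outputPMF (O : Oracle) (c : Polynomial ℕ) (x : List Bool) :
    oracleCoinPMF O c x = (oracleRandAlg O c).outputPMF id x :=
  rfl

/-- **Eq. (5.80): the oracle's mass at an outcome is a witness count** of the coin predicate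
`samplerRel (oracleRandAlg 𝒪 c)` ("`⟨⟨x, y⟩, r⟩` with `𝒪(⟨x, r⟩) = y`") at the instance `⟨x, y⟩`:
`𝒟_𝒪(x)(y) = #{r ∈ {0,1}^ℓ | 𝒪(⟨x, r⟩) = y} / 2^ℓ`, `ℓ = c(|x|)` (`toReal_outputPMF_apply`).
[cite: AaronsonArkhipovToC2013, proof of Thm. 1.3, eq. (5.80) (p. 193)] -/
theorem toReal_oracleCoinPMF_apply (O : Oracle) (c : Polynomial ℕ) (x y : List Bool) :
    (oracleCoinPMF O c x y).toReal =
      (countWitnesses (samplerRel (oracleRandAlg O c)) (c.eval x.length) (boolPair x y) : ℝ) /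
        2 ^ (c.eval x.length) :=
  toReal_outputPMF_apply (oracleRandAlg O c) x y

/-- Hence the planted mass of the oracle's law at the padded query `⟨x, 1^k⟩` (`oracleSamplePMF`) is
the witness count of `samplerRel (oracleRandAlg 𝒪 c)` at `⟨⟨x, 1^k⟩, S*_ι⟩` over `2^ℓ` — the quantity
Stockmeyer's Thm. 4.1 (`stockmeyerApproxCounting`) estimates. [cite: AaronsonArkhipovToC2013, proof of Thm. 1.3, eq. (5.80) (p. 193)] -/
theorem plantedMass_oracleSamplePMF (O : Oracle) (c : Polynomial ℕ) (x : List Bool) (k : ℕ)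
    (ι : Fin n ↪ Fin m) :
    plantedMass (oracleSamplePMF O c x k) ι =
      (countWitnesses (samplerRel (oracleRandAlg O c)) (c.eval (boolPair x (unaryEncodeNat k)).length)
          (boolPair (boolPair x (unaryEncodeNat k)) (plantedOutcome ι)) : ℝ) /
        2 ^ (c.eval (boolPair x (unaryEncodeNat k)).length) := by
  rw [plantedMass, oracleSamplePMF, toReal_oracleCoinPMF_apply]

/-- **Eq. (5.89) in the tree's accuracy notion.** An approximate count within the factor
`1 + 1/kη` (`IsApproxCount`, the guarantee of `stockmeyerApproxCounting`) is within relative error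
`1/kη`: `|Ñ/L − N/L| ≤ (1/kη)·(N/L)` for any normalisation `L > 0` (AA13:
`Pr[|q̃_{S*} − q_{S*}| > α·q_{S*}] < 2^{-m}`; `N/(1+η) ≥ (1−η)N`). [cite: AaronsonArkhipovToC2013, proof of Thm. 1.3, eq. (5.89) (p. 194) with Thm. 4.1 (p. 175)] -/
theorem abs_sub_le_of_isApproxCount {kη N Nt : ℕ} (hk : 0 < kη) (h : IsApproxCount kη N Nt)
    {L : ℝ} (hL : 0 < L) :
    |(Nt : ℝ) / L - (N : ℝ) / L| ≤ 1 / (kη : ℝ) * ((N : ℝ) / L) := by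
  obtain ⟨hlo, hhi⟩ := h
  have hη : (0 : ℝ) < 1 / (kη : ℝ) := by positivity
  have hN : (0 : ℝ) ≤ N := Nat.cast_nonneg _
  -- lower bound: `N/(1+η) ≥ (1 - η) N`
  have hlo' : (1 - 1 / (kη : ℝ)) * N ≤ Nt := by
    refine le_trans ?_ hlo
    rw [le_div_iff₀ (by positivity)]
    have hsq : 0 ≤ (1 / (kη : ℝ)) ^ 2 * N := by positivity
    nlinarith [hsq]
  rw [← sub_div, abs_div, abs_of_pos hL, div_le_iff₀ hL]
  rw [show 1 / (kη : ℝ) * ((N : ℝ) / L) * L = 1 / (kη : ℝ) * N by field_simp]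
  rw [abs_le]
  constructor <;> nlinarith

/-! ### Combining the estimates (eqs. (5.93)–(5.97)) -/

/-- **Eqs. (5.93)–(5.95), the deterministic core of the union bound.** With `α = εδ/16` and
`k = 4/δ`: if the Stockmeyer estimate is `α`-relatively accurate (`|q̃ − q| ≤ α·q`), the planted mass
is not too large (`q ≤ 2k/mⁿ = (8/δ)/mⁿ`) and the discrepancy is small (`|p − q| ≤ (ε/2)/mⁿ`), then
`|q̃ − p| ≤ ε/mⁿ` (`αq ≤ (εδ/16)(8/δ)/mⁿ = (ε/2)/mⁿ`). [cite: AaronsonArkhipovToC2013, proof of Thm. 1.3, eqs. (5.93)–(5.95) (p. 195)] -/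
theorem abs_estimate_sub_planted_le {p q qt ε δ M : ℝ} (hδ : 0 < δ) (hM : 0 < M)
    (hacc : |qt - q| ≤ ε * δ / 16 * q) (hmass : q ≤ 8 / δ / M) (hdelta : |p - q| ≤ ε / 2 / M)
    (hε : 0 ≤ ε) :
    |qt - p| ≤ ε / M := by
  have h1 : ε * δ / 16 * q ≤ ε / 2 / M := by
    calc ε * δ / 16 * q ≤ ε * δ / 16 * (8 / δ / M) := by
          apply mul_le_mul_of_nonneg_left hmass; positivity
      _ = ε / 2 / M := by field_simp; ring
  calc |qt - p| = |(qt - q) + (q - p)| := by ring_nf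
    _ ≤ |qt - q| + |q - p| := abs_add_le _ _
    _ ≤ ε / 2 / M + ε / 2 / M := by
        rw [abs_sub_comm q p]
        exact add_le_add (hacc.trans h1) hdelta
    _ = ε / M := by ring

/-- **Back to `|Per X|²` (eq. (5.78) with (5.79)).** If the planted block of the column-orthonormal
`A` at `ι` is `X/√m` and `|q̃ − p_ι| ≤ ε/mⁿ`, then the rescaled estimate `n!·mⁿ·q̃` is within
`ε·n!` of `|Per X|²`. [cite: AaronsonArkhipovToC2013, proof of Thm. 1.3, eqs. (5.78)–(5.79) (p. 193)] -/
theorem abs_rescaled_estimate_sub_le [NeZero m] {U : Matrix (Fin m) (Fin n) ℂ}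
    (hU : IsColumnOrthonormal U) (ι : Fin n ↪ Fin m) (X : Matrix (Fin n) (Fin n) ℂ)
    (hplant : U.submatrix ι id = ((Real.sqrt m)⁻¹ : ℝ) • X) {qt ε : ℝ}
    (hest : |qt - (bosonTargetPMF U (plantedOutcome ι)).toReal| ≤ ε / (m : ℝ) ^ n) :
    |(n.factorial : ℝ) * (m : ℝ) ^ n * qt - ‖X.permanent‖ ^ 2| ≤ ε * n.factorial := by
  have hm : 0 < m := Nat.pos_of_ne_zero (NeZero.ne m)
  have hmn : 0 < (m : ℝ) ^ n := by positivity
  have hfac : (0 : ℝ) < n.factorial := by exact_mod_cast n.factorial_pos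
  rw [toReal_bosonTargetPMF_plantedOutcome hU ι, hplant, norm_sq_permanent_inv_sqrt_smul X hm]
    at hest
  have key : (n.factorial : ℝ) * (m : ℝ) ^ n * qt - ‖X.permanent‖ ^ 2 =
      ((n.factorial : ℝ) * (m : ℝ) ^ n) * (qt - ‖X.permanent‖ ^ 2 / (m : ℝ) ^ n / n.factorial) := by
    field_simp
  rw [key, abs_mul, abs_of_pos (by positivity)]
  calc (n.factorial : ℝ) * (m : ℝ) ^ n * |qt - ‖X.permanent‖ ^ 2 / (m : ℝ) ^ n / n.factorial|
      ≤ (n.factorial : ℝ) * (m : ℝ) ^ n * (ε / (m : ℝ) ^ n) := by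
        apply mul_le_mul_of_nonneg_left hest; positivity
    _ = ε * n.factorial := by field_simp

/-- **Eqs. (5.96)–(5.97), the failure budget.** With `k = 4/δ` the four failure sources — hiding
fails (`≤ δ/4`), planted mass too large (`≤ 1/k = δ/4`), Stockmeyer fails (`≤ 2^{-m}`), discrepancy
too large (`≤ δ/4`) — total `< δ` as soon as `2^{-m} < δ/4`.
[cite: AaronsonArkhipovToC2013, proof of Thm. 1.3, eqs. (5.96)–(5.97) (p. 195)] -/
theorem failure_budget_lt {δ f₁ f₂ f₃ f₄ : ℝ} {m : ℕ} (h₁ : f₁ ≤ δ / 4) (h₂ : f₂ ≤ δ / 4)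
    (h₃ : f₃ ≤ (2 : ℝ)⁻¹ ^ m) (h₄ : f₄ ≤ δ / 4) (hm : (2 : ℝ)⁻¹ ^ m < δ / 4) :
    f₁ + f₂ + f₃ + f₄ < δ := by
  linarith

end Literature.Computability.QuantumComplexity
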